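import Literature.AnabelianGeometry.SemiGraphs.ProSigmaCompletionProfiniteExtend
import Literature.AnabelianGeometry.SemiGraphs.ProSigmaCompletionHomCount
import Literature.AnabelianGeometry.AbsoluteAnabelian.LocalReciprocityCofinal
import Mathlib.Topology.Homeomorph.Lemmas
import Mathlib.GroupTheory.Commutator.Basic
import Mathlib.GroupTheory.NoncommPiCoprod
import Mathlib.Algebra.Group.Equiv.TypeTags
import HarnessLib

/-!
# Pro-`Σ` completions, IV: additivity of ranks in extensions (hom-count form)

[CombGC] Remark 1.1.4 (Mochizuki, *A combinatorial version of the Grothendieck conjecture*, Tohoku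
Math. J. **59** (2007), p. 8): the subquotients `M^cusp_G ⊆ M^edge_G ⊆ M^vert_G ⊆ M_G` of the
abelianization are "free and finitely generated over `Ẑ^Σ`", and the proof of Theorem 1.6 (ii) (p. 14,
"by Proposition 1.3 … `α` is numerically cuspidal", via Remark 1.3.1 p. 10: "one may compute `r(G)` as
soon as one knows the difference between the ranks of `M^edge_{G'}`, `M_{G'}/M^vert_{G'}`") ADDS ranks
along the extension `0 → M^cusp → M^edge → M^edge/M^cusp → 0`.  In the tree's rendering ("free of rank
`r`" = "a pro-`Σ` completion of `ℤ^r`", `PSCGraphicitySub.lean`; rank read off through the number of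
continuous homomorphisms to `ℤ/l`, `ProSigmaCompletionHomCount.lean`) this additivity is the following
theorem of profinite group theory, proved here (sub-DAG row CombGC:Thm1.6/T16-L08, "statement IV"):

* `natCard_continuousMonoidHom_subquotient_eq_mul` — for closed subgroups `D ≤ K ≤ E` of a
  profinite pro-`Σ` group `P` with `⁅E, E⁆ ≤ D` and `E/K` a pro-`Σ` completion of `ℤ^r`, and a prime
  `l ∈ Σ`:  `#Hom_cts(E/D, ℤ/l) = #Hom_cts(K/D, ℤ/l) · l^r`.

Route: a continuous SECTION `E/K → E/D` exists by the universal property for profinite targets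
(`exists_continuous_extend_profinite`, part III) — `exists_continuous_section`; an abelian compact
group with a continuous section over a closed subgroup is topologically the product —
`natCard_continuousMonoidHom_eq_mul_of_section`; continuous homomorphisms out of a product to a
commutative group are pairs — `natCard_continuousMonoidHom_prod`.  Plain profinite group theory; no
statement of the papers is restated; nothing here takes a side on [IUTchIII] Cor. 3.12.
-/

namespace Literature.AnabelianGeometry.SemiGraphs.SemiGraphOfAnabelioids.IsProSigmaCompletion

open Literature.AnabelianGeometry.Anabelioids Topology

variable {Sigma : Set ℕ}

/-! ### Continuous homomorphisms out of a product -/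

/-- Continuous homomorphisms `A × C → Q` to a commutative topological group are the pairs of continuous
homomorphisms `A → Q`, `C → Q` (`F ↦ (F ∘ inl, F ∘ inr)`, `(f, g) ↦ f · g`).
[cite: MochizukiCombGC2007, Rmk 1.1.4 p.8] -/
theorem natCard_continuousMonoidHom_prod (A C Q : Type*) [Group A] [Group C] [TopologicalSpace A]
    [TopologicalSpace C] [CommGroup Q] [TopologicalSpace Q] [ContinuousMul Q] :
    Nat.card {F : A × C →* Q // Continuous F} =
      Nat.card {F : A →* Q // Continuous F} * Nat.card {F : C →* Q // Continuous F} := by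
  rw [← Nat.card_prod]
  refine Nat.card_congr
    { toFun := fun F => (⟨F.1.comp (MonoidHom.inl A C), F.2.comp ?_⟩,
        ⟨F.1.comp (MonoidHom.inr A C), F.2.comp ?_⟩)
      invFun := fun fg => ⟨fg.1.1.coprod fg.2.1,
        (fg.1.2.comp continuous_fst).mul (fg.2.2.comp continuous_snd)⟩
      left_inv := fun F => Subtype.ext (MonoidHom.coprod_unique F.1)
      right_inv := fun fg => Prod.ext (Subtype.ext (MonoidHom.coprod_comp_inl _ _))
        (Subtype.ext (MonoidHom.coprod_comp_inr _ _)) }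
  · exact continuous_id.prodMk continuous_const
  · exact continuous_const.prodMk continuous_id

/-! ### An extension with a continuous section is topologically a product -/

section Section

variable {X : Type*} [Group X] [TopologicalSpace X] [IsTopologicalGroup X] [T2Space X]
  {A : Type*} [Group A] [TopologicalSpace A] [CompactSpace A]
  {C : Type*} [Group C] [TopologicalSpace C] [CompactSpace C]

/-- **Splitting.**  Let `X` be a Hausdorff group in which all elements commute, `j : A → X` a
continuous injective homomorphism from a compact group, `π : X → C` a continuous homomorphism onto (in
the sense `Ker π = Im j`) a compact group `C`, and `s : C → X` a continuous homomorphic section of `π`.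
Then `(a, c) ↦ j(a) · s(c)` is an isomorphism of topological groups `A × C ≅ X`.
[cite: MochizukiCombGC2007, Rmk 1.1.4 p.8] -/
theorem exists_continuousMulEquiv_prod_of_section (hX : ∀ x y : X, Commute x y) (j : A →* X)
    (hj : Continuous j) (hjinj : Function.Injective j) (π : X →* C) (hexact : π.ker = j.range)
    (s : C →* X) (hs : Continuous s) (hsec : ∀ c, π (s c) = c) :
    ∃ e : A × C ≃ₜ* X, ∀ p, e p = j p.1 * s p.2 := by
  -- the candidate homomorphism
  let Φ : A × C →* X :=
    { toFun := fun p => j p.1 * s p.2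
      map_one' := by simp
      map_mul' := fun p q => by
        simp only [Prod.fst_mul, Prod.snd_mul, map_mul]
        rw [mul_assoc, mul_assoc, ← mul_assoc (j q.1), (hX (j q.1) (s p.2)).eq, mul_assoc] }
  have hΦc : Continuous Φ := (hj.comp continuous_fst).mul (hs.comp continuous_snd)
  have hπj : ∀ a, π (j a) = 1 := fun a => by
    rw [← MonoidHom.mem_ker, hexact]; exact ⟨a, rfl⟩
  have hΦinj : Function.Injective Φ := by
    rw [injective_iff_map_eq_one]
    rintro ⟨a, c⟩ h
    change j a * s c = 1 at h
    have hc : c = 1 := by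
      have := congrArg π h
      rwa [map_mul, hπj, one_mul, hsec, map_one] at this
    subst hc
    rw [map_one, mul_one] at h
    have ha : a = 1 := hjinj (by rw [h, map_one])
    subst ha; rfl
  have hΦsurj : Function.Surjective Φ := fun x => by
    have hx : x * (s (π x))⁻¹ ∈ j.range := by
      rw [← hexact, MonoidHom.mem_ker, map_mul, map_inv, hsec, mul_inv_cancel]
    obtain ⟨a, ha⟩ := hx
    exact ⟨(a, π x), by change j a * s (π x) = x; rw [ha, inv_mul_cancel_right]⟩
  let eqv : A × C ≃ X := Equiv.ofBijective Φ ⟨hΦinj, hΦsurj⟩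
  let h : A × C ≃ₜ X := Continuous.homeoOfEquivCompactToT2 (f := eqv) hΦc
  exact ⟨{ h with map_mul' := fun p q => Φ.map_mul p q }, fun p => rfl⟩

/-- **Hom-count of a split extension.**  In the situation of
`exists_continuousMulEquiv_prod_of_section`, for every commutative topological group `Q`:
`#Hom_cts(X, Q) = #Hom_cts(A, Q) · #Hom_cts(C, Q)`. [cite: MochizukiCombGC2007, Rmk 1.1.4 p.8] -/
theorem natCard_continuousMonoidHom_eq_mul_of_section (hX : ∀ x y : X, Commute x y) (j : A →* X)
    (hj : Continuous j) (hjinj : Function.Injective j) (π : X →* C) (hexact : π.ker = j.range)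
    (s : C →* X) (hs : Continuous s) (hsec : ∀ c, π (s c) = c) (Q : Type*) [CommGroup Q]
    [TopologicalSpace Q] [ContinuousMul Q] :
    Nat.card {F : X →* Q // Continuous F} =
      Nat.card {F : A →* Q // Continuous F} * Nat.card {F : C →* Q // Continuous F} := by
  obtain ⟨e, -⟩ := exists_continuousMulEquiv_prod_of_section hX j hj hjinj π hexact s hs hsec
  rw [← natCard_continuousMonoidHom_congr e Q, natCard_continuousMonoidHom_prod]

end Section

/-! ### Sections over a free pro-`Σ` quotient -/

section FreeQuotient

/-- `ℤ^r` (multiplicative copy) is generated by the standard generators.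
[cite: MochizukiCombGC2007, Rmk 1.1.4 p.8] -/
theorem closure_range_ofAdd_single (r : ℕ) :
    Subgroup.closure (Set.range fun i : Fin r => Multiplicative.ofAdd (Pi.single i (1 : ℤ))) = ⊤ := by
  rw [Subgroup.eq_top_iff']
  intro v
  have key : v = ∏ i, Multiplicative.ofAdd (Pi.single i (1 : ℤ)) ^ (Multiplicative.toAdd v i) := by
    apply Multiplicative.toAdd.injective
    rw [toAdd_prod]
    simp only [toAdd_zpow, toAdd_ofAdd]
    have : ∀ i, (Multiplicative.toAdd v i) • (Pi.single i (1 : ℤ) : Fin r → ℤ) =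
        Pi.single i (Multiplicative.toAdd v i) := fun i => by
      ext k
      by_cases hk : k = i
      · subst hk; simp
      · simp [hk]
    simp only [this]
    exact (Finset.univ_sum_single _).symm
  rw [key]
  refine Subgroup.prod_mem _ fun i _ => Subgroup.zpow_mem _ (Subgroup.subset_closure (Set.mem_range_self i)) _

/-- Homomorphisms out of `ℤ^r` (multiplicative copy) are determined by the standard generators.
[cite: MochizukiCombGC2007, Rmk 1.1.4 p.8] -/
theorem monoidHom_pi_int_ext {r : ℕ} {C : Type*} [Group C]
    {g h : Multiplicative (Fin r → ℤ) →* C}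
    (H : ∀ i, g (Multiplicative.ofAdd (Pi.single i (1 : ℤ))) =
      h (Multiplicative.ofAdd (Pi.single i (1 : ℤ)))) :
    g = h :=
  MonoidHom.eq_of_eqOn_dense (closure_range_ofAdd_single r) (by rintro _ ⟨i, rfl⟩; exact H i)

variable {X : Type*} [Group X] [TopologicalSpace X] [IsTopologicalGroup X] [CompactSpace X]
  [TotallyDisconnectedSpace X] {C : Type*} [Group C] [TopologicalSpace C] [IsTopologicalGroup C]
  [T2Space C]

/-- **A continuous section over a free pro-`Σ` quotient.**  Let `X` be a profinite pro-`Σ` group in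
which all elements commute, `π : X → C` a continuous surjective homomorphism onto a Hausdorff group
`C` that is a pro-`Σ` completion of `ℤ^r`.  Then `π` has a continuous homomorphic section (lift the
`r` generators, extend by the universal property for profinite targets, and use density).
[cite: MochizukiCombGC2007, Rmk 1.1.4 p.8] -/
theorem exists_continuous_section (hXc : ∀ x y : X, Commute x y)
    (hX : ∀ V : Subgroup X, V.Normal → IsOpen (V : Set X) → IsSigmaInteger Sigma V.index)
    (π : X →* C) (hπ : Continuous π) (hπs : Function.Surjective π) {r : ℕ}
    {ι : Multiplicative (Fin r → ℤ) →* C} (hι : IsProSigmaCompletion Sigma ι) :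
    ∃ s : C →* X, Continuous s ∧ ∀ c, π (s c) = c := by
  classical
  -- lift the generators
  choose x hx using fun i : Fin r => hπs (ι (Multiplicative.ofAdd (Pi.single i (1 : ℤ))))
  -- `f : ℤ^r → X`, `e_i ↦ x_i` (the images commute)
  let ϕ : ∀ _ : Fin r, Multiplicative ℤ →* X := fun i => zpowersHom X (x i)
  have hϕ : Pairwise fun i j => ∀ a b, Commute (ϕ i a) (ϕ j b) := fun _ _ _ a b => hXc _ _
  let f : Multiplicative (Fin r → ℤ) →* X :=
    (MonoidHom.noncommPiCoprod ϕ hϕ).comp (MulEquiv.funMultiplicative (Fin r) ℤ).toMonoidHom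
  have hf : ∀ i, f (Multiplicative.ofAdd (Pi.single i (1 : ℤ))) = x i := fun i => by
    have hsingle : MulEquiv.funMultiplicative (Fin r) ℤ (Multiplicative.ofAdd (Pi.single i (1 : ℤ))) =
        Pi.mulSingle i (Multiplicative.ofAdd (1 : ℤ)) := by
      funext k
      by_cases hk : k = i
      · subst hk; simp
      · simp [Pi.mulSingle, Function.update, hk]
    change MonoidHom.noncommPiCoprod ϕ hϕ
      (MulEquiv.funMultiplicative (Fin r) ℤ (Multiplicative.ofAdd (Pi.single i (1 : ℤ)))) = x i
    rw [hsingle, MonoidHom.noncommPiCoprod_mulSingle]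
    simp [ϕ]
  have hπf : π.comp f = ι := monoidHom_pi_int_ext fun i => by
    rw [MonoidHom.comp_apply, hf, hx]
  -- extend along `ι` to a continuous `s : C → X`
  obtain ⟨s, hsc, hsι⟩ := exists_continuous_extend_profinite hι hX f
  refine ⟨s, hsc, fun c => ?_⟩
  have key : π.comp s = MonoidHom.id C :=
    continuous_extend_profinite_unique hι (hπ.comp hsc) continuous_id fun γ => by
      rw [MonoidHom.comp_apply, hsι, ← MonoidHom.comp_apply, hπf, MonoidHom.id_apply]
  exact DFunLike.congr_fun key c

end FreeQuotient

/-! ### Subquotients of a profinite pro-`Σ` group -/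

section Algebra

variable {P : Type*} [Group P] {D K E : Subgroup P}

/-- `⁅E, E⁆ ≤ N` makes `N ∩ E` normal in `E`. [cite: MochizukiCombGC2007, Def 1.1(ii) p.7] -/
theorem normal_subgroupOf_of_commutator_le {N E : Subgroup P} (h : ⁅E, E⁆ ≤ N) :
    (N.subgroupOf E).Normal := by
  refine ⟨fun n hn e => ?_⟩
  change ((e : P) * n * (e : P)⁻¹) ∈ N
  have hc : (e : P) * n * (e : P)⁻¹ * (n : P)⁻¹ ∈ N :=
    h (Subgroup.commutator_mem_commutator e.2 n.2)
  have : (e : P) * n * (e : P)⁻¹ = (e : P) * n * (e : P)⁻¹ * (n : P)⁻¹ * n := by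
    rw [inv_mul_cancel_right]
  rw [this]
  exact N.mul_mem hc hn

/-- All elements of `E / (D ∩ E)` commute when `⁅E, E⁆ ≤ D`. [cite: MochizukiCombGC2007, Def 1.1(ii) p.7] -/
theorem commute_quotient_subgroupOf (h : ⁅E, E⁆ ≤ D) [(D.subgroupOf E).Normal]
    (x y : E ⧸ D.subgroupOf E) : Commute x y := by
  obtain ⟨a, rfl⟩ := QuotientGroup.mk_surjective x
  obtain ⟨b, rfl⟩ := QuotientGroup.mk_surjective y
  change (QuotientGroup.mk a : E ⧸ D.subgroupOf E) * QuotientGroup.mk b =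
    QuotientGroup.mk b * QuotientGroup.mk a
  rw [← QuotientGroup.mk_mul, ← QuotientGroup.mk_mul, QuotientGroup.eq]
  change ((a * b)⁻¹ * (b * a) : E).1 ∈ D
  have hc : ((b : E) : P)⁻¹ * ((a : E) : P)⁻¹ * ((b : E) : P)⁻¹⁻¹ * ((a : E) : P)⁻¹⁻¹ ∈ D :=
    h (Subgroup.commutator_mem_commutator (E.inv_mem b.2) (E.inv_mem a.2))
  have : ((a * b)⁻¹ * (b * a) : E).1 =
      ((b : E) : P)⁻¹ * ((a : E) : P)⁻¹ * ((b : E) : P)⁻¹⁻¹ * ((a : E) : P)⁻¹⁻¹ := by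
    simp [mul_assoc]
  rw [this]
  exact hc

/-- The inclusion `K/(D ∩ K) → E/(D ∩ E)` for `K ≤ E`. [cite: MochizukiCombGC2007, Def 1.1(ii) p.7] -/
theorem subgroupOf_le_comap_inclusion (hKE : K ≤ E) :
    D.subgroupOf K ≤ (D.subgroupOf E).comap (Subgroup.inclusion hKE) := fun _ h => h

/-- The projection `E/(D ∩ E) → E/(K ∩ E)` for `D ≤ K`. [cite: MochizukiCombGC2007, Def 1.1(ii) p.7] -/
theorem subgroupOf_le_comap_id (hDK : D ≤ K) :
    D.subgroupOf E ≤ (K.subgroupOf E).comap (MonoidHom.id E) := fun _ h => hDK h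

end Algebra

section Subquotient

variable {P : Type*} [Group P] [TopologicalSpace P] [IsTopologicalGroup P] [CompactSpace P]
  [TotallyDisconnectedSpace P]

/-- An open subgroup of a subgroup `E` (subspace topology) of a profinite pro-`Σ` group has `Σ`-integer
index in `E`: it contains `E ∩ M` for some open normal `M ⊴ P`, and `[E : E ∩ M] ∣ [P : M]`.
[cite: MochizukiSemiAnbd2006, Ex. 2.10 p.31] -/
theorem isSigmaInteger_index_of_isOpen_subgroupOf
    (hP : ∀ M : Subgroup P, M.Normal → IsOpen (M : Set P) → IsSigmaInteger Sigma M.index)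
    (E : Subgroup P) (V : Subgroup E) (hV : IsOpen (V : Set E)) : IsSigmaInteger Sigma V.index := by
  obtain ⟨O, hO, hOV⟩ := isOpen_induced_iff.mp hV
  have h1O : (1 : P) ∈ O := by
    have : ((1 : E) : P) ∈ O := by
      change (1 : E) ∈ Subtype.val ⁻¹' O
      rw [hOV]; exact V.one_mem
    simpa using this
  obtain ⟨M, hM⟩ := ProfiniteGrp.exist_openNormalSubgroup_sub_open_nhds_of_one hO h1O
  have hle : (M : Subgroup P).subgroupOf E ≤ V := by
    intro e he
    have : (e : P) ∈ O := hM he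
    change e ∈ Subtype.val ⁻¹' O at this
    rwa [hOV] at this
  refine (hP _ M.isNormal' M.isOpen').of_dvd ((Subgroup.index_dvd_of_le hle).trans ?_)
  rw [Subgroup.subgroupOf, Subgroup.index_comap, Subgroup.range_subtype]
  exact Subgroup.relIndex_dvd_index_of_normal _ _

/-- The quotient of a subgroup `E` of a profinite pro-`Σ` group by a normal subgroup is pro-`Σ` (every
open subgroup has `Σ`-integer index). [cite: MochizukiSemiAnbd2006, Ex. 2.10 p.31] -/
theorem isSigmaInteger_index_quotient_subgroupOf
    (hP : ∀ M : Subgroup P, M.Normal → IsOpen (M : Set P) → IsSigmaInteger Sigma M.index)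
    (E : Subgroup P) (N : Subgroup E) [N.Normal] (V : Subgroup (E ⧸ N)) (hV : IsOpen (V : Set (E ⧸ N))) :
    IsSigmaInteger Sigma V.index := by
  rw [← Subgroup.index_comap_of_surjective V (QuotientGroup.mk'_surjective N)]
  exact isSigmaInteger_index_of_isOpen_subgroupOf hP E _ (hV.preimage QuotientGroup.continuous_mk)

variable {D K E : Subgroup P}

/-- **Additivity of ranks along `0 → K/D → E/D → E/K → 0` (hom-count form), [CombGC] Rmk. 1.1.4.**
Let `P` be a profinite pro-`Σ` group, `D ≤ K ≤ E` closed subgroups with `⁅E, E⁆ ≤ D`, and suppose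
`E/K` is a pro-`Σ` completion of `ℤ^r`.  Then for every prime `l ∈ Σ`:
`#Hom_cts(E/D, ℤ/l) = #Hom_cts(K/D, ℤ/l) · l^r` — i.e. "rank `E/D` = rank `K/D` + rank `E/K`" in the
currency of `ProSigmaCompletionHomCount.lean`. [cite: MochizukiCombGC2007, Rmk 1.1.4 p.8] -/
theorem natCard_continuousMonoidHom_subquotient_eq_mul
    (hP : ∀ M : Subgroup P, M.Normal → IsOpen (M : Set P) → IsSigmaInteger Sigma M.index)
    (hDK : D ≤ K) (hKE : K ≤ E) (hD : IsClosed (D : Set P)) (hK : IsClosed (K : Set P))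
    (hE : IsClosed (E : Set P)) (hcomm : ⁅E, E⁆ ≤ D) [(D.subgroupOf E).Normal]
    [(D.subgroupOf K).Normal] [(K.subgroupOf E).Normal] {r : ℕ}
    {ι : Multiplicative (Fin r → ℤ) →* E ⧸ K.subgroupOf E} (hι : IsProSigmaCompletion Sigma ι)
    {l : ℕ} (hl : l.Prime) (hlS : l ∈ Sigma) :
    Nat.card {F : (E ⧸ D.subgroupOf E) →* Multiplicative (ZMod l) //
        @Continuous _ (Multiplicative (ZMod l)) _ ⊥ F} =
      Nat.card {F : (K ⧸ D.subgroupOf K) →* Multiplicative (ZMod l) //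
        @Continuous _ (Multiplicative (ZMod l)) _ ⊥ F} * l ^ r := by
  letI : TopologicalSpace (Multiplicative (ZMod l)) := ⊥
  haveI : DiscreteTopology (Multiplicative (ZMod l)) := ⟨rfl⟩
  haveI : ContinuousMul (Multiplicative (ZMod l)) := ⟨continuous_of_discreteTopology⟩
  -- topology of the three subquotients
  haveI : CompactSpace E := isCompact_iff_compactSpace.mp hE.isCompact
  haveI : CompactSpace K := isCompact_iff_compactSpace.mp hK.isCompact
  have hDE : IsClosed ((D.subgroupOf E : Subgroup E) : Set E) := hD.preimage continuous_subtype_val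
  have hKE' : IsClosed ((K.subgroupOf E : Subgroup E) : Set E) := hK.preimage continuous_subtype_val
  haveI : IsClosed ((D.subgroupOf E : Subgroup E) : Set E) := hDE
  haveI : IsClosed ((K.subgroupOf E : Subgroup E) : Set E) := hKE'
  haveI : TotallyDisconnectedSpace (E ⧸ D.subgroupOf E) :=
    AbsoluteAnabelian.QuotientGroup.totallyDisconnectedSpace_of_isClosed _ hDE
  haveI : TotallyDisconnectedSpace (E ⧸ K.subgroupOf E) :=
    AbsoluteAnabelian.QuotientGroup.totallyDisconnectedSpace_of_isClosed _ hKE'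
  -- the maps `j : K/D → E/D`, `π : E/D → E/K`
  let j : (K ⧸ D.subgroupOf K) →* (E ⧸ D.subgroupOf E) :=
    QuotientGroup.map _ _ (Subgroup.inclusion hKE) (subgroupOf_le_comap_inclusion hKE)
  let π : (E ⧸ D.subgroupOf E) →* (E ⧸ K.subgroupOf E) :=
    QuotientGroup.map _ _ (MonoidHom.id E) (subgroupOf_le_comap_id hDK)
  have hjc : Continuous j := by
    apply (QuotientGroup.isQuotientMap_mk _).continuous_iff.mpr
    exact QuotientGroup.continuous_mk.comp (continuous_inclusion hKE)
  have hπc : Continuous π := by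
    apply (QuotientGroup.isQuotientMap_mk _).continuous_iff.mpr
    exact QuotientGroup.continuous_mk.comp continuous_id
  have hjinj : Function.Injective j := by
    rw [injective_iff_map_eq_one]
    intro x hx
    obtain ⟨k, rfl⟩ := QuotientGroup.mk_surjective x
    rw [QuotientGroup.map_mk, QuotientGroup.eq_one_iff] at hx
    rw [QuotientGroup.eq_one_iff]
    exact hx
  have hπs : Function.Surjective π := by
    intro y
    obtain ⟨e, rfl⟩ := QuotientGroup.mk_surjective y
    exact ⟨QuotientGroup.mk e, by rw [QuotientGroup.map_mk]; rfl⟩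
  have hexact : π.ker = j.range := by
    ext x
    obtain ⟨e, rfl⟩ := QuotientGroup.mk_surjective x
    rw [MonoidHom.mem_ker, QuotientGroup.map_mk, MonoidHom.id_apply, QuotientGroup.eq_one_iff]
    constructor
    · intro he
      exact ⟨QuotientGroup.mk ⟨(e : P), he⟩, by rw [QuotientGroup.map_mk]; rfl⟩
    · rintro ⟨y, hy⟩
      obtain ⟨k, rfl⟩ := QuotientGroup.mk_surjective y
      rw [QuotientGroup.map_mk, QuotientGroup.eq] at hy
      have hk : ((Subgroup.inclusion hKE k)⁻¹ * e : E).1 ∈ D := hy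
      have : (e : P) = (k : P) * ((Subgroup.inclusion hKE k)⁻¹ * e : E).1 := by
        simp
      change (e : P) ∈ K
      rw [this]
      exact K.mul_mem k.2 (hDK hk)
  -- a continuous section of `π` (`E/D` is abelian)
  have hXc := commute_quotient_subgroupOf (D := D) (E := E) hcomm
  obtain ⟨s, hsc, hsec⟩ := exists_continuous_section hXc
    (fun V _ hV => isSigmaInteger_index_quotient_subgroupOf hP E _ V hV) π hπc hπs hι
  rw [natCard_continuousMonoidHom_eq_mul_of_section hXc j hjc hjinj π hexact s hsc hsec
    (Multiplicative (ZMod l)), natCard_continuousMonoidHom_zmod hι hl hlS]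

end Subquotient

end Literature.AnabelianGeometry.SemiGraphs.SemiGraphOfAnabelioids.IsProSigmaCompletion
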